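import Mathlib
import Summits.KontsevichZagierPeriods.Zeta5Search.SorokinCensus.GeneralizedReversalCoords
import HarnessLib

/-!
HONEST FRAMING: systematic search; no irrationality claim unless certified.

# The generalized Sorokin family `J₅^gen` — Reversal (FAMILY.md §17; = Fischler's `𝒥(p)`, C. R. Math. 335 (2002) §3)

This module: the integrand in u-coordinates (`GenPoint.hU`), `reversalInvariance_holds : ReversalInvariance`, the UNCONDITIONAL `balancedDecompositionIntegrable_holds : BalancedDecompositionIntegrable`, rationality of raw points with `a₀ ≤ 0` (`integral_cube5_monomial`, `integral_aeval5_rational`, `GenPoint.rational_of_nonpos`, `odd_of_nonpos`), and the reduction `balancedOddIntegrable_of : RawLocusOdd → BalancedOddIntegrable`.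

fam-sorokin gen 4 (planner-pub-zeta5-fam-sorokin-g4-0), staged `SorokinGeneralized.lean` v9 (sha256 e6bbed22…, 1570 l., filing request #2 FINAL-6 = last); split by the cell filing lane (lead/lit g11) at the gate's 400-line cap into `Generalized` (defs + statement nodes) → `GeneralizedSigma` → `GeneralizedMoves` → `GeneralizedEuler` → `GeneralizedReversalCoords` → `GeneralizedReversal` (linear import chain; mathematics verbatim, one-line docstrings added where missing, a private cube-measurability lemma duplicated across the split).
Nothing here is an irrationality statement: elementary identities / calculus of absolutely convergent 5-fold integrals and integer bookkeeping.
-/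

namespace Summit.KontsevichZagierPeriods.Zeta5Search.SorokinCensus

open Literature.NumberTheory.Irrationality.Zudilin2002 MeasureTheory Finset Set
open GenPoint

/-! ### The integrand in u-coordinates and the two pointwise identities -/

/-- `one_sub_tailQ_zero`: `(x : Fin 5 → ℝ) : 1 - tailQ x 0 = x 0 * tailQ x 1`. -/
theorem one_sub_tailQ_zero (x : Fin 5 → ℝ) : 1 - tailQ x 0 = x 0 * tailQ x 1 := by rw [tailQ_zero_eq']; ring
/-- `one_sub_tailQ_two`: `(x : Fin 5 → ℝ) : 1 - tailQ x 2 = x 2 * tailQ x 3`. -/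
theorem one_sub_tailQ_two (x : Fin 5 → ℝ) : 1 - tailQ x 2 = x 2 * tailQ x 3 := by rw [tailQ_step2]; ring
/-- `one_sub_tailQ_three`: `(x : Fin 5 → ℝ) : 1 - tailQ x 3 = x 3 * tailQ x 4`. -/
theorem one_sub_tailQ_three (x : Fin 5 → ℝ) : 1 - tailQ x 3 = x 3 * tailQ x 4 := by rw [tailQ_step3]; ring
/-- `one_sub_tailQ_four`: `(x : Fin 5 → ℝ) : 1 - tailQ x 4 = x 4`. -/
theorem one_sub_tailQ_four (x : Fin 5 → ℝ) : 1 - tailQ x 4 = x 4 := by rw [tailQ_four_eq]; ring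
/-- `tailQ_add_zero`: `(x : Fin 5 → ℝ) : tailQ x 0 + tailQ x 1 - 1 = tailQ x 1 * (1 - x 0)`. -/
theorem tailQ_add_zero (x : Fin 5 → ℝ) : tailQ x 0 + tailQ x 1 - 1 = tailQ x 1 * (1 - x 0) := by
  rw [tailQ_zero_eq']; ring
/-- `tailQ_add_one`: `(x : Fin 5 → ℝ) : tailQ x 1 + tailQ x 2 - 1 = tailQ x 2 * (1 - x 1)`. -/
theorem tailQ_add_one (x : Fin 5 → ℝ) : tailQ x 1 + tailQ x 2 - 1 = tailQ x 2 * (1 - x 1) := by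
  rw [tailQ_step1]; ring
/-- `tailQ_add_two`: `(x : Fin 5 → ℝ) : tailQ x 2 + tailQ x 3 - 1 = tailQ x 3 * (1 - x 2)`. -/
theorem tailQ_add_two (x : Fin 5 → ℝ) : tailQ x 2 + tailQ x 3 - 1 = tailQ x 3 * (1 - x 2) := by
  rw [tailQ_step2]; ring
/-- `tailQ_add_three`: `(x : Fin 5 → ℝ) : tailQ x 3 + tailQ x 4 - 1 = tailQ x 4 * (1 - x 3)`. -/
theorem tailQ_add_three (x : Fin 5 → ℝ) : tailQ x 3 + tailQ x 4 - 1 = tailQ x 4 * (1 - x 3) := by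
  rw [tailQ_step3]; ring

namespace GenPoint

/-- The integrand in u-coordinates, already multiplied by `|det D(Xmap⁻¹)| = (u₂u₃u₄u₅)⁻¹`: a Laurent monomial in
`1-u_i`, `u_i+u_{i+1}-1` (`= |t_i - t_{i+1}|`) and `u_i`. -/
noncomputable def hU (p : GenPoint) (u : Fin 5 → ℝ) : ℝ :=
  (1 - u 0) ^ (p.a 0 - 1) * (1 - u 1) ^ (p.a 1 - 1) * (1 - u 2) ^ (p.a 2 - 1) * (1 - u 3) ^ (p.a 3 - 1) *
      (1 - u 4) ^ (p.a 4 - 1) *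
    ((u 0 + u 1 - 1) ^ (p.c 0 - 1) * (u 1 + u 2 - 1) ^ (p.c 1 - 1) * (u 2 + u 3 - 1) ^ (p.c 2 - 1) *
      (u 3 + u 4 - 1) ^ (p.c 3 - 1)) *
    (u 0 ^ (-p.a₀) * u 1 ^ (1 - p.b 0 - p.e 1) * u 2 ^ (1 - p.b 1 - p.e 2) * u 3 ^ (1 - p.b 2 - p.e 3) *
      u 4 ^ (p.c 4 - p.b 3))

/-- Pointwise identity on the open cube: `|det D Xmap| · hU (Xmap x) = integrand x`. -/
theorem integrand_eq_hU_Xmap (p : GenPoint) {x : Fin 5 → ℝ} (hx : x ∈ ocube) :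
    |(XDeriv x).det| * p.hU (Xmap x) = p.integrand x := by
  obtain ⟨_, h1, h2, h3, h4⟩ := tailQ_bounds' hx
  have n1 := h1.1.ne'
  have n2 := h2.1.ne'
  have n3 := h3.1.ne'
  have n4 := h4.1.ne'
  rw [abs_det_XDeriv hx]
  unfold hU integrand
  simp only [Fin.prod_univ_five, Xmap_apply_zero, Xmap_apply_one, Xmap_apply_two, Xmap_apply_three,
    Xmap_apply_four, GenPoint.c]
  rw [one_sub_tailQ_zero, one_sub_tailQ_one, one_sub_tailQ_two, one_sub_tailQ_three, one_sub_tailQ_four,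
    tailQ_add_zero, tailQ_add_one, tailQ_add_two, tailQ_add_three, ← tailQ_four_eq x]
  have e1 : tailQ x 1 ^ (-p.e 1) = tailQ x 1 * tailQ x 1 ^ (p.a 0 - 1) * tailQ x 1 ^ (p.b 0 - p.a 0 - 1) *
      tailQ x 1 ^ (1 - p.b 0 - p.e 1) := by
    rw [show -p.e 1 = 1 + (p.a 0 - 1) + (p.b 0 - p.a 0 - 1) + (1 - p.b 0 - p.e 1) by ring, zpow_add₀ n1,
      zpow_add₀ n1, zpow_add₀ n1, zpow_one]
  have e2 : tailQ x 2 ^ (-p.e 2) = tailQ x 2 * tailQ x 2 ^ (p.a 1 - 1) * tailQ x 2 ^ (p.b 1 - p.a 1 - 1) *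
      tailQ x 2 ^ (1 - p.b 1 - p.e 2) := by
    rw [show -p.e 2 = 1 + (p.a 1 - 1) + (p.b 1 - p.a 1 - 1) + (1 - p.b 1 - p.e 2) by ring, zpow_add₀ n2,
      zpow_add₀ n2, zpow_add₀ n2, zpow_one]
  have e3 : tailQ x 3 ^ (-p.e 3) = tailQ x 3 * tailQ x 3 ^ (p.a 2 - 1) * tailQ x 3 ^ (p.b 2 - p.a 2 - 1) *
      tailQ x 3 ^ (1 - p.b 2 - p.e 3) := by
    rw [show -p.e 3 = 1 + (p.a 2 - 1) + (p.b 2 - p.a 2 - 1) + (1 - p.b 2 - p.e 3) by ring, zpow_add₀ n3,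
      zpow_add₀ n3, zpow_add₀ n3, zpow_one]
  have e4 : tailQ x 4 ^ (p.b 4 - p.a 4 - 1) = tailQ x 4 * tailQ x 4 ^ (p.a 3 - 1) * tailQ x 4 ^ (p.b 3 - p.a 3 - 1) *
      tailQ x 4 ^ (p.b 4 - p.a 4 - p.b 3) := by
    rw [show p.b 4 - p.a 4 - 1 = 1 + (p.a 3 - 1) + (p.b 3 - p.a 3 - 1) + (p.b 4 - p.a 4 - p.b 3) by ring,
      zpow_add₀ n4, zpow_add₀ n4, zpow_add₀ n4, zpow_one]
  rw [e1, e2, e3, e4]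
  simp only [mul_zpow]
  ring

/-- The exponent dictionary of path reversal: `hU (rev p) = hU p ∘ urev` identically. -/
theorem hU_rev (p : GenPoint) (u : Fin 5 → ℝ) : p.rev.hU u = p.hU (urev u) := by
  simp only [hU, rev_a₀, rev_a, rev_b, rev_e, GenPoint.c, urev_apply_zero, urev_apply_one, urev_apply_two,
    urev_apply_three, urev_apply_four, Matrix.cons_val_zero, Matrix.cons_val_one, Matrix.cons_val_two,
    Matrix.cons_val_three, Matrix.cons_val_four, Matrix.head_cons, Matrix.tail_cons]
  ring_nf

/-- `J(p)` as an integral over the zigzag cell in u-coordinates. -/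
theorem J_eq_cell (p : GenPoint) : p.J = ∫ u in cell, p.hU u := by
  have hderiv : ∀ x ∈ ocube, HasFDerivWithinAt Xmap (XDeriv x) ocube x :=
    fun x _ => (hasFDerivAt_Xmap x).hasFDerivWithinAt
  have hI := integral_image_eq_integral_abs_det_fderiv_smul volume measurableSet_ocube hderiv Xmap_injOn p.hU
  rw [Xmap_image] at hI
  rw [hI, p.J_eq_ocube]
  refine setIntegral_congr_fun measurableSet_ocube fun x hx => ?_
  simp only [smul_eq_mul]
  exact (p.integrand_eq_hU_Xmap hx).symm

/-- `integrable_iff_cell`: `(p : GenPoint) : p.Integrable ↔ IntegrableOn p.hU cell`. -/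
theorem integrable_iff_cell (p : GenPoint) : p.Integrable ↔ IntegrableOn p.hU cell := by
  have hderiv : ∀ x ∈ ocube, HasFDerivWithinAt Xmap (XDeriv x) ocube x :=
    fun x _ => (hasFDerivAt_Xmap x).hasFDerivWithinAt
  have hInt := integrableOn_image_iff_integrableOn_abs_det_fderiv_smul volume measurableSet_ocube hderiv
    Xmap_injOn p.hU
  rw [Xmap_image] at hInt
  rw [hInt, p.integrable_iff_ocube]
  refine integrableOn_congr_fun (fun x hx => ?_) measurableSet_ocube
  simp only [smul_eq_mul]
  exact (p.integrand_eq_hU_Xmap hx).symm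

end GenPoint

/-- **`ReversalInvariance` holds**: `J(p) = J(rev p)` and integrability corresponds, for every parameter point. -/
theorem reversalInvariance_holds : ReversalInvariance := by
  intro p
  have hemb : MeasurableEmbedding urev := urevEquiv.measurableEmbedding
  refine ⟨?_, ?_⟩
  · rw [p.J_eq_cell, p.rev.J_eq_cell]
    have key := measurePreserving_urev.setIntegral_preimage_emb hemb p.hU cell
    rw [urev_preimage_cell] at key
    rw [← key]
    exact setIntegral_congr_fun measurableSet_cell fun u _ => (p.hU_rev u).symm
  · rw [p.integrable_iff_cell, p.rev.integrable_iff_cell]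
    have key := measurePreserving_urev.integrableOn_comp_preimage hemb (f := p.hU) (s := cell)
    rw [urev_preimage_cell] at key
    rw [← key]
    have hfun : p.hU ∘ urev = p.rev.hU := funext fun u => (p.hU_rev u).symm
    rw [hfun]

/-- **THEOREM 17d(⇐) (FAMILY.md), unconditional in the kernel**: every balanced admissible convergent integrable point of
the generalized family is a positive-integer combination of RAW points on the very-well-poised locus. -/
theorem balancedDecompositionIntegrable_holds : BalancedDecompositionIntegrable :=
  balancedDecompositionIntegrable_of eulerInvariance_holds reversalInvariance_holds


/-! ## Raw points with `a₀ ≤ 0` have rational values (PROVED)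

For a raw admissible point with `a₀ ≤ 0` every exponent of the integrand is a natural number, so the integrand is
(the evaluation of) a polynomial with rational — indeed integer — coefficients in `x₁,…,x₅`, and its integral over the
closed unit cube is a rational number (Fubini on monomials: `∫ x^s = ∏ 1/(sᵢ+1)`). This settles the lower-weight terms
(`a₀ ≤ 0`) of the balanced-pole decomposition, so that `RawLocusOdd` only speaks about `a₀ ≥ 1` (the locus `L₅`). -/

/-- `restrict_cube5`: `: (volume : Measure (Fin 5 → ℝ)).restrict (cube 5) = Measure.pi fun _ : Fin 5 => (volume : Measure ℝ).restr…`. -/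
theorem restrict_cube5 :
    (volume : Measure (Fin 5 → ℝ)).restrict (cube 5) =
      Measure.pi fun _ : Fin 5 => (volume : Measure ℝ).restrict (Icc 0 1) := by
  rw [cube, volume_pi]
  exact Measure.restrict_pi_pi (fun _ : Fin 5 => (volume : Measure ℝ)) (fun _ => Icc 0 1)

/-- `integral_cube5_monomial`: `(s : Fin 5 → ℕ) : ∫ x in cube 5, ∏ i, x i ^ s i = ∏ i : Fin 5, (1 : ℝ) / ((s i : ℝ) + 1)`. -/
theorem integral_cube5_monomial (s : Fin 5 → ℕ) :
    ∫ x in cube 5, ∏ i, x i ^ s i = ∏ i : Fin 5, (1 : ℝ) / ((s i : ℝ) + 1) := by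
  rw [restrict_cube5]
  rw [integral_fintype_prod_eq_prod (𝕜 := ℝ) (fun i (t : ℝ) => t ^ s i)]
  refine Finset.prod_congr rfl fun i _ => ?_
  show ∫ t in Icc (0:ℝ) 1, t ^ s i = 1 / ((s i : ℝ) + 1)
  rw [integral_Icc_eq_integral_Ioc, ← intervalIntegral.integral_of_le zero_le_one, integral_pow]
  simp

/-- `continuous_aeval5`: `(φ : MvPolynomial (Fin 5) ℚ) : Continuous fun x : Fin 5 → ℝ => MvPolynomial.aeval x φ`. -/
theorem continuous_aeval5 (φ : MvPolynomial (Fin 5) ℚ) :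
    Continuous fun x : Fin 5 → ℝ => MvPolynomial.aeval x φ := by
  have h : (fun x : Fin 5 → ℝ => MvPolynomial.aeval x φ) =
      fun x => MvPolynomial.eval x (MvPolynomial.map (algebraMap ℚ ℝ) φ) := by
    funext x
    rw [MvPolynomial.eval_map, MvPolynomial.aeval_def]
  rw [h]
  exact MvPolynomial.continuous_eval _

/-- `integrableOn_aeval5`: `(φ : MvPolynomial (Fin 5) ℚ) : IntegrableOn (fun x : Fin 5 → ℝ => MvPolynomial.aeval x φ) (cube 5)`. -/
theorem integrableOn_aeval5 (φ : MvPolynomial (Fin 5) ℚ) :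
    IntegrableOn (fun x : Fin 5 → ℝ => MvPolynomial.aeval x φ) (cube 5) :=
  (continuous_aeval5 φ).continuousOn.integrableOn_compact (isCompact_univ_pi fun _ => isCompact_Icc)

/-- The integral over the closed unit cube of a polynomial with rational coefficients is a rational number. -/
theorem integral_aeval5_rational (φ : MvPolynomial (Fin 5) ℚ) :
    ∃ r : ℚ, ∫ x in cube 5, MvPolynomial.aeval x φ = (r : ℝ) := by
  induction φ using MvPolynomial.induction_on' with
  | monomial u a =>
    refine ⟨a * ∏ i, 1 / ((u i : ℚ) + 1), ?_⟩
    simp only [MvPolynomial.aeval_monomial, Finsupp.prod_fintype _ _ (fun i => pow_zero _)]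
    rw [integral_const_mul, integral_cube5_monomial]
    push_cast
    congr 1
  | add p q hp hq =>
    obtain ⟨r, hr⟩ := hp
    obtain ⟨r', hr'⟩ := hq
    refine ⟨r + r', ?_⟩
    simp only [map_add]
    rw [integral_add (integrableOn_aeval5 p) (integrableOn_aeval5 q), hr, hr']
    push_cast
    ring

namespace GenPoint

/-- The integrand of a raw point with `a₀ ≤ 0`, as a polynomial with rational coefficients. -/
noncomputable def poly (q : GenPoint) : MvPolynomial (Fin 5) ℚ :=
  (∏ j : Fin 5, MvPolynomial.X j ^ (q.a j - 1).toNat * (1 - MvPolynomial.X j) ^ (q.c j - 1).toNat) *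
    (1 - MvPolynomial.X 0 * (1 - MvPolynomial.X 1 * (1 - MvPolynomial.X 2 *
      (1 - MvPolynomial.X 3 * (1 - MvPolynomial.X 4))))) ^ (-q.a₀).toNat

/-- `integrand_eq_aeval`: `(q : GenPoint) (hraw : q.Raw) (hadm : q.Admissible) (h0 : q.a₀ ≤ 0) (x : Fin 5 → ℝ) : q.integrand x = MvPol…`. -/
theorem integrand_eq_aeval (q : GenPoint) (hraw : q.Raw) (hadm : q.Admissible) (h0 : q.a₀ ≤ 0)
    (x : Fin 5 → ℝ) : q.integrand x = MvPolynomial.aeval x q.poly := by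
  obtain ⟨e1, e2, e3⟩ := hraw
  have ha : ∀ j, x j ^ (q.a j - 1) = x j ^ (q.a j - 1).toNat := fun j => by
    rw [← zpow_natCast, Int.toNat_of_nonneg (by linarith [(hadm j).1])]
  have hc : ∀ j, (1 - x j) ^ (q.c j - 1) = (1 - x j) ^ (q.c j - 1).toNat := fun j => by
    rw [← zpow_natCast, Int.toNat_of_nonneg (by unfold GenPoint.c; linarith [(hadm j).2])]
  have h0' : tailQ x 0 ^ (-q.a₀) = tailQ x 0 ^ (-q.a₀).toNat := by
    rw [← zpow_natCast, Int.toNat_of_nonneg (by linarith)]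
  unfold integrand
  rw [h0']
  simp only [e1, e2, e3, neg_zero, zpow_zero, mul_one, ha, hc, tailQ_zero_eq, poly, map_mul, map_prod,
    map_pow, map_sub, map_one, MvPolynomial.aeval_X]

/-- A raw admissible point with `a₀ ≤ 0` has a RATIONAL value. -/
theorem rational_of_nonpos (q : GenPoint) (hraw : q.Raw) (hadm : q.Admissible) (h0 : q.a₀ ≤ 0) :
    ∃ r : ℚ, q.J = r := by
  have h : q.integrand = fun x => MvPolynomial.aeval x q.poly := funext (q.integrand_eq_aeval hraw hadm h0)
  rw [J, h]
  exact integral_aeval5_rational q.poly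

/-- Hence such a point is (trivially) odd: its value lies in `ℚ ⊂ ℚ + ℚζ(3) + ℚζ(5)`. -/
theorem odd_of_nonpos (q : GenPoint) (hraw : q.Raw) (hadm : q.Admissible) (h0 : q.a₀ ≤ 0) : q.Odd := by
  obtain ⟨r, hr⟩ := q.rational_of_nonpos hraw hadm h0
  exact ⟨![r, 0, 0], by simp [hr]⟩

end GenPoint

/-- **BALANCED ⇒ ODD, reduced to the arithmetic of the raw locus `L₅` (`a₀ ≥ 1`)**: `RawLocusOdd → BalancedOddIntegrable` (an
`ℕ`-combination of values in `ℚ + ℚζ(3) + ℚζ(5)` lies there; the terms with `a₀ ≤ 0` are rational by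
`GenPoint.odd_of_nonpos`). The hypothesis `1 ≤ p.a₀` of `BalancedOddIntegrable` is not even needed. -/
theorem balancedOddIntegrable_of (h : RawLocusOdd) : BalancedOddIntegrable := by
  intro p hadm hconv hint _ hbal
  obtain ⟨n, m, q, hq, hJ⟩ := balancedDecompositionIntegrable_holds p hadm hconv hint hbal
  have hodd : ∀ t, (q t).Odd := fun t =>
    (le_or_gt 1 (q t).a₀).elim (fun h1 => h (q t) (hq t).1 (hq t).2.1 (hq t).2.2.1 (hq t).2.2.2 h1)
      (fun h1 => GenPoint.odd_of_nonpos (q t) (hq t).1 (hq t).2.2.1 (by omega))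
  choose r hr using hodd
  refine ⟨![∑ t, (m t : ℚ) * r t 0, ∑ t, (m t : ℚ) * r t 1, ∑ t, (m t : ℚ) * r t 2], ?_⟩
  rw [hJ]
  simp only [Matrix.cons_val_zero, Matrix.cons_val_one, Matrix.cons_val_two, Matrix.head_cons, Matrix.tail_cons]
  push_cast
  simp only [hr]
  rw [Finset.sum_mul, Finset.sum_mul, ← Finset.sum_add_distrib, ← Finset.sum_add_distrib]
  exact Finset.sum_congr rfl fun t _ => by ring

/-- The landed v2 node `ReversalIdentity` (with its unused hypotheses) follows from `ReversalInvariance`. -/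
theorem reversalIdentity_holds : ReversalIdentity := fun p _ _ _ => (reversalInvariance_holds p).1

end Summit.KontsevichZagierPeriods.Zeta5Search.SorokinCensus
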